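/-
Copyright (c) 2026 the pub-hodgecm-mathlib formalisation cell (harness21).  Prover seat hodgecm-mathlib-K2E3-p06 (g4), Track B «K2-LIT», engine E3, unit U4 «Keys»; Road II′
(U4-f residue (R1): EVERY RAMIFIED place, tame or wild — the `h2`-free rung); 2026-09-04.  The §1∕§2 proofs are K2E3-p05 (g3)'s TAME-RAMIFIED rung VERBATIM with the two
★ swaps (S1) «ramified quadratic datum of the place» and (S2) «wild-tree Iwahori indices» (dealer K2E3-plan (g3) default 03:56:07Z «U4-f wild-ramified rung», lead RULINGS #19).
KERNEL module: THEOREMS ONLY (no definition, no named fact, no `sorry`, no instance, no notation).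
-/
import Summits.HodgeConjecture.HodgeConjecture.Theorems.K2E3KeysThmTwoIwahoriCriterionPF      -- ★-filed (this seat): `criterion_of_data` place-free + `pair_algebra`; brings II-1∕2∕3-PF
import Summits.HodgeConjecture.HodgeConjecture.Theorems.K2E3IwahoriScalarExplicitPF          -- ★-filed p857065 (this seat): the explicit `d` over `hϖ`, `‖ϖ_E‖ = N(w)⁻¹`
import Summits.HodgeConjecture.HodgeConjecture.Theorems.K2E3KeysThmTwoIwahoriQuartet          -- ★ p856874 (this seat): `eq_one_of_levelTrivial`, `weyl_levelTrivial`; brings ★ (H1), ★ NonUnitaryCharacterDichotomy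
import Summits.HodgeConjecture.HodgeConjecture.Theorems.K2E3UnramifiedCharacterValueAtUniformizer   -- ★ p855859 (g0): `eq_halfModulusChar_sq_of_apply_uniformizer`
import Summits.HodgeConjecture.HodgeConjecture.Theorems.K2E3KeysThmTwoContractingUnramified          -- ★ p856959 (K2E3-p05 (g3)): the INERT rung `keysThmTwoContracting_of_unramified_inert` (§3 dispatch)
import Summits.HodgeConjecture.HodgeConjecture.Theorems.F0P3cDyRamWildPlaceDatum              -- ★ p854601 (LH4-p02): `exists_isRamifiedQuadraticDatum_of_placesOver` (the datum `IsRamifiedQuadraticDatum σ_w ϖ d t` at EVERY ramified non-split CM place)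
import Literature.NumberTheory.Automorphic.UnitaryLatticeTreeLevelIndicesWild                   -- ★ (LH4-p01): `index_inf_subgroupOf_eq_of_isRamifiedQuadraticDatum` (`[K₀:I] = [K₁:I] = q + 1` at ANY ramified datum, wild included)
import Literature.RingTheory.DiscreteValuationRing.AdicCompletionResidueField                    -- ★ `natCard_residueField_adicCompletion` (`|𝓀[L_w]| = N(w)`)
import HarnessLib

/-!
# K2 ∕ E3 «EllipticInputs», unit U4 «Keys» — Road II′: KEYS' THEOREM §7 (2) («Re s > 0» form) AT EVERY RAMIFIED NON-SPLIT PLACE (TAME OR WILD) FOR `χ` TRIVIAL ON `T ∩ K_v`: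
# a reducible `i_G(χ₁, χ₂)` with `χ₁` non-unitary contracting has `χ₁ = ‖·‖_E` (point (a) only)   [Keys1984 §7 Thm (2)(a); Rogawski1990 §12.2 (1); Casselman1980 §3; Tits1979 §2.4, §2.7]

Cell hodgecm-mathlib (D-0151), FLOOR 0, Track B «K2-LIT», engine E3, crux item H413 = stmt-HodgeConjecture-24833 (route `HCCMUnconditional`, no route verbs); target BY NAME
`…K2E3EllipticInputs.U4Keys.sig_K2E3KeysThmTwoContracting` (U4-f).  Author K2E3-p06 (g4) over K2E3-p05 (g3)'s tame-ramified rung (Road II′ owner; proofs verbatim, two ★ swaps).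
`--supports stmt-HodgeConjecture-24833 --as helper`; THEOREMS ONLY.
THIS IS THE RAMIFIED RUNG (residue (R1) of MEMO v4 at EVERY ramified place, dyadic∕wild included), NOT THE PAYER: U4-f's binder text VERBATIM plus two hypotheses — `hram : e(w|v) ≠ 1`
for every `w ∣ v` (`v` RAMIFIED in `L∕L⁺`) and `hU : χ` trivial on `T ∩ K_v` (UNRAMIFIED `χ`); NO `|2|_w = 1`.  With the inert rung ★ p856959 this covers EVERY non-split place for
unramified `χ`; the residue of U4-f is then (R2) «`χ` ramified» only (Road I: the γ-factor of the rank-one intertwining operator).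

THE MATHEMATICS.  Road II verbatim over the place-free layer: ANY uniformiser `ϖ` of `L_w` carries a RAMIFIED QUADRATIC DATUM `IsRamifiedQuadraticDatum σ_w ϖ d t` (★
`exists_isRamifiedQuadraticDatum_of_placesOver`: `σ_w` an isometric involution, `σ_w`-fixed non-zero elements of even valuation, `|ϖ − σ_wϖ| = |ϖ|^d` with `d ≥ 1` the different
number — `d = 1 ⟺ |2|_w = 1` —, `|2|_w = |ϖ|^t`); `g₁ = diag(1,1,ϖ)`, `eA = ` ★ `localNonsplitEquiv` on `Φ₃`, levels `K₀, K₁, I`; ★ `criterion_of_data` (PF) with the explicit `d` of ★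
`exists_borel_mul_weyl_mem_K1_explicit` (PF) gives the four equations in `|R|`, `|R′|` and `μ = χ(proj d)·δ_B^{1∕2}(d) = χ₁(ϖ_E)⁻¹·N(w)` (`χ₂ = 1` by ★ `eq_one_of_levelTrivial`;
`‖ϖ_E‖ = N(w)⁻¹` ★), where `|R| = |R′| = N(w) + 1` at ANY ramified datum (★ `index_inf_subgroupOf_eq_of_isRamifiedQuadraticDatum` — the wild lattice tree: both vertices special at every
residue characteristic, Tits 1979 §2.7; `|𝓀[L_w]| = N(w)` ★); ★ `pair_algebra`: `z = χ₁(ϖ_E) = N(w)⁻¹ = ‖ϖ_E‖`, i.e. `χ₁ = ‖·‖_E` (★ `eq_halfModulusChar_sq_of_apply_uniformizer`).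
Point (c) cannot occur: an unramified `η` never restricts to the ramified `ω_{E∕F}`.  The two swaps against the tame rung: (S1) the tame block ★ `ramifiedBlock_adicCompletion (h2)` ↦ the
datum of the place; (S2) ★ `index_inf_subgroupOf_eq_of_ramified (hσϖ) (hres) (h2) (hnorm)` ↦ ★ `index_inf_subgroupOf_eq_of_isRamifiedQuadraticDatum (hD)` (same conclusion token for token).
HONEST LABEL: HC_CM is proved only modulo the 7 printed citations (2 remaining named inputs: hLiu418 = stmt-HodgeConjecture-24832, h413 = stmt-HodgeConjecture-24833)
until rung 0 closes; count-neutral — the ramified rung does NOT pay U4-f; no printed citation is discharged.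

## References
* [Keys1984] D. Keys, Compositio Math. 51 (1984), §7 Theorem (2) (a) p. 126.  * [Rogawski1990] J. D. Rogawski, Ann. of Math. Stud. 123 (1990), §12.2 (1) p. 173.
* [Casselman1980] W. Casselman, Compositio Math. 40 (1980), §3.  * [Borel1976] A. Borel, Invent. Math. 35 (1976), §4.  * [Tits1979] J. Tits, PSPM 33.1 (1979), §2.4, §2.7.
* [Serre1979] J.-P. Serre, *Local Fields*, GTM 67 (1979), Ch. IV §1 Prop. 4, §2 (the different of a ramified quadratic extension, dyadic case included).
-/

set_option autoImplicit false
-- the mandated namespace has the single-problem summit's repeated segment (`HodgeConjecture.HodgeConjecture`)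
set_option linter.dupNamespace false

noncomputable section

open NumberField IsDedekindDomain MeasureTheory
open scoped Matrix MatrixGroups NNReal WithZero Valued
open Literature.NumberTheory Literature.NumberTheory.Automorphic Literature.NumberTheory.Automorphic.UnitaryGroup
open Literature.NumberTheory.Rogawski1990 Literature.NumberTheory.GaloisRepresentations Literature.NumberTheory.Automorphic.UnitaryThreeFourFrame

namespace Summit.HodgeConjecture.HodgeConjecture.Cruxes.H413.K2E3KeysThmTwoContractingRamified

open Summit.HodgeConjecture.HodgeConjecture.Cruxes.H413
open Summit.HodgeConjecture.HodgeConjecture.Cruxes.H413.F0P3cStCharTSStLevelsTransport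
open Summit.HodgeConjecture.HodgeConjecture.Cruxes.H413.K2E3KeysThmTwoIwahoriQuartet
open Summit.HodgeConjecture.HodgeConjecture.Cruxes.H413.K2E3KeysThmTwoIwahoriCriterionPF
open Summit.HodgeConjecture.HodgeConjecture.Cruxes.H413.K2E3IwahoriScalarExplicitPF
open Summit.HodgeConjecture.HodgeConjecture.Cruxes.H413.K2E3UnramifiedCharacterValueAtUniformizer

variable (L : Type) [Field L] [NumberField L] [IsCMField L] (v : HeightOneSpectrum (𝓞 ↥(maximalRealSubfield L)))

/-! ## §1 At a ramified quadratic datum: `χ₁(ϖ_E) = N(w)⁻¹` -/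

variable (w : PlacesOver L v) (hw : IsCMField.complexConj L • w.1 = w.1)
  (eA : Gqs L v ≃ₜ* ↥(unitaryGroupOfForm (galAdicCompletionMap (L := L) (IsCMField.complexConj L) hw) ((StdForm.antidiagonal 3).over (w.1.adicCompletion L))))
  (heA : ∀ g : Gqs L v,
    ((eA g : ↥(unitaryGroupOfForm (galAdicCompletionMap (L := L) (IsCMField.complexConj L) hw) ((StdForm.antidiagonal 3).over (w.1.adicCompletion L)))) : GL (Fin 3) (w.1.adicCompletion L)) =
      ((localNonsplitEquiv (IsCMField.complexConj L) (qsForm L) (IsCMField.complexConj_ne_one L) w hw g :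
        ↥(unitaryGroupOfForm (galAdicCompletionMap (L := L) (IsCMField.complexConj L) hw) (placeForm (qsForm L) w.1))) : GL (Fin 3) (w.1.adicCompletion L)))

include heA in
set_option maxHeartbeats 6400000 in
set_option synthInstance.maxHeartbeats 400000 in
-- statement∕proof-heavy: the `SmoothInd` carrier of `cmPrincipalSeries` and the (G3) letters (class of ★ p856874 §4)
/-- **THE VALUE AT A RAMIFIED PLACE, TAME OR WILD.**  `v` non-split, `ϖ` a uniformiser of `L_w` carrying a RAMIFIED QUADRATIC DATUM `IsRamifiedQuadraticDatum σ_w ϖ d t`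
(★ `exists_isRamifiedQuadraticDatum_of_placesOver`: every uniformiser at every ramified non-split CM place does; `d` = the different number, `d = 1` iff `|2|_w = 1`),
`χ = (χ₁, χ₂)` continuous with `χ₁` NON-UNITARY and CONTRACTING, `χ` trivial on `T ∩ K_v`, `i_G(χ)` REDUCIBLE: then `χ₁(ϖ_E) = N(w)⁻¹` for every uniformiser unit `ϖ_E` of `E_v`
(`N(w) = |𝓞_L ∕ 𝔭_w|`) — ★ `criterion_of_data` (PF) + the explicit `d` (PF) + the indices `[K₀:I] = [K₁:I] = N(w) + 1` at ANY ramified datum ★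
`index_inf_subgroupOf_eq_of_isRamifiedQuadraticDatum` (wild lattice tree) + ★ `pair_algebra`.  K2E3-p05 (g3)'s tame proof verbatim with swap (S2).
[cite: Keys1984, §7 Theorem (2) (a) p. 126] [cite: Casselman1980, §3] [cite: Tits1979, §2.4, §2.7] -/
theorem apply_uniformizer_eq_of_isRamifiedQuadraticDatum (hns : ∀ w' : PlacesOver L v, IsCMField.complexConj L • w'.1 = w'.1) {ϖ : w.1.adicCompletion L} {nd nt : ℕ}
    (hD : IsRamifiedQuadraticDatum (galAdicCompletionMap (L := L) (IsCMField.complexConj L) hw) ϖ nd nt)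
    (g₁ : GL (Fin 3) (w.1.adicCompletion L)) (hg₁ : (g₁ : Matrix (Fin 3) (Fin 3) (w.1.adicCompletion L)) = Matrix.diagonal ![(1 : w.1.adicCompletion L), 1, ϖ])
    (K0 K1 I : Subgroup (Gqs L v))
    (hK0 : K0 = ((glInt 3 (w.1.adicCompletion L)).subgroupOf
      (unitaryGroupOfForm (galAdicCompletionMap (L := L) (IsCMField.complexConj L) hw) ((StdForm.antidiagonal 3).over (w.1.adicCompletion L)))).comap
        eA.toMulEquiv.toMonoidHom)
    (hK1 : K1 = (((glInt 3 (w.1.adicCompletion L)).map (MulAut.conj g₁).toMonoidHom).subgroupOf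
      (unitaryGroupOfForm (galAdicCompletionMap (L := L) (IsCMField.complexConj L) hw) ((StdForm.antidiagonal 3).over (w.1.adicCompletion L)))).comap
        eA.toMulEquiv.toMonoidHom)
    (hI : I = K0 ⊓ K1)
    (χ₁ : (LocalRing L v)ˣ →* ℂˣ) (χ₂ : ↥(normOneUnits (conjLocal L (IsCMField.complexConj L) v)) →* ℂˣ)
    (h₁ : Continuous fun x => ((χ₁ x : ℂˣ) : ℂ)) (h₂ : Continuous fun x => ((χ₂ x : ℂˣ) : ℂ))
    (hnu : ∃ x, ‖((χ₁ x : ℂˣ) : ℂ)‖ ≠ 1)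
    (hcontr : ∀ x : (LocalRing L v)ˣ, unitModulusChar (LocalRing L v) x < 1 → ‖((χ₁ x : ℂˣ) : ℂ)‖ < 1)
    (hU : ∀ t : ↥(torusU (conjLocal L (IsCMField.complexConj L) v) (cmLocalForm L 3 v)),
      (t : ↥(unitaryGroupOfForm (conjLocal L (IsCMField.complexConj L) v) (cmLocalForm L 3 v))) ∈ cmLocalIntegralLevel L 3 (qsForm L) v → cmTorusCharPair L v χ₁ χ₂ t = 1)
    (hred : ∃ N : Subrepresentation (cmPrincipalSeries L 3 v (cmTorusCharPair L v χ₁ χ₂)), N ≠ ⊥ ∧ N ≠ ⊤)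
    (ϖE : (LocalRing L v)ˣ) (hϖE : ∀ w' : PlacesOver L v, Valued.v ((ϖE : LocalRing L v) w') = WithZero.exp (-1 : ℤ)) :
    ((χ₁ ϖE : ℂˣ) : ℂ) = ((Nat.card (𝓞 L ⧸ w.1.asIdeal) : ℂ))⁻¹ := by
  classical
  haveI := locallyCompactSpace_cmBorelU L 3 v
  have hϖ : Valued.v ϖ = WithZero.exp (-1 : ℤ) := hD.2.2.1
  -- regular, `χ₂ = 1`, `χ₁` unramified, `wχ` unramified
  have hreg := K2E3NonUnitaryCharacterDichotomy.cmTorusCharPair_ne_weyl_of_exists_norm_ne_one L v hns χ₁ χ₂ h₁ hnu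
  have hχ₂ : χ₂ = 1 := eq_one_of_levelTrivial L v hns χ₁ χ₂ hU
  have hχ₁U : ∀ u ∈ (Submonoid.pi Set.univ (fun w' : PlacesOver L v => (w'.1.adicCompletionIntegers L).toSubring.toSubmonoid)).units, χ₁ u = 1 :=
    fun u hu => K2E3SphericalCFunctionUnramifiedHypotheses.apply_eq_one_of_mem_unitsIntegers_of_trivial L v hns χ₁ χ₂ hU u hu
  have hUw := weyl_levelTrivial L v hns χ₁ χ₂ hU
  obtain ⟨N, hbot, htop⟩ := hred
  -- the explicit `d`, transversals, the criterion (place-free)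
  obtain ⟨d, hdK1, hdw, hduni, hdδ⟩ := exists_borel_mul_weyl_mem_K1_explicit L v w hw eA heA hϖ g₁ hg₁ K1 hK1
  have hlev := isOpen_isCompact_levels L v w hw eA g₁ K0 K1 I hK0 hK1 hI
  obtain ⟨R, hR⟩ := exists_isLeftTransversal (B := K0) (T := I) hlev.1.2 hlev.2.2.1
  obtain ⟨R', hR'⟩ := exists_isLeftTransversal (B := K1) (T := I) hlev.2.1.2 hlev.2.2.1
  have hcrit := criterion_of_data L v w hw eA heA hns hϖ g₁ hg₁ K0 K1 I hK0 hK1 hI χ₁ χ₂ h₁ h₂ hreg hU hUw N hbot htop d hdK1 R hR R' hR'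
  -- the indices `|R| = |R′| = N(w) + 1` at ANY ramified datum (swap (S2): the wild lattice tree, ★ `index_inf_subgroupOf_eq_of_isRamifiedQuadraticDatum`)
  obtain ⟨q, hqdef⟩ : ∃ q : ℕ, q = Nat.card (𝓞 L ⧸ w.1.asIdeal) := ⟨_, rfl⟩
  rw [← hqdef]
  have hidx := UnitaryLatticeTree.index_inf_subgroupOf_eq_of_isRamifiedQuadraticDatum (galAdicCompletionMap (L := L) (IsCMField.complexConj L) hw) ϖ nd nt hD g₁ hg₁
  rw [IsDedekindDomain.HeightOneSpectrum.natCard_residueField_adicCompletion L w.1, ← hqdef] at hidx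
  have hKI0 : K0 ⊓ I = I := by rw [hI]; exact inf_eq_right.2 inf_le_left
  have hKI1 : K1 ⊓ I = I := by rw [hI]; exact inf_eq_right.2 inf_le_right
  have hRcard : R.card = q + 1 := by
    rw [K2E3IwahoriScalarExplicit.card_eq_index_of_isLeftTransversal hR, hKI0, hI, hK0, hK1, ← Subgroup.comap_inf, ← Subgroup.relIndex, Subgroup.relIndex_comap,
      Subgroup.map_comap_eq_self_of_surjective eA.surjective, Subgroup.relIndex]
    exact hidx.1
  have hR'card : R'.card = q + 1 := by
    rw [K2E3IwahoriScalarExplicit.card_eq_index_of_isLeftTransversal hR', hKI1, hI, hK0, hK1, ← Subgroup.comap_inf, ← Subgroup.relIndex, Subgroup.relIndex_comap,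
      Subgroup.map_comap_eq_self_of_surjective eA.surjective, Subgroup.relIndex]
    exact hidx.2
  have hn : (R.card : ℂ) = (q : ℂ) + 1 := by rw [hRcard]; push_cast; ring
  have hm : (R'.card : ℂ) = (q : ℂ) + 1 := by rw [hR'card]; push_cast; ring
  rw [hn, hm] at hcrit
  -- `μ = χ₁(ϖ_E)⁻¹ · N(w)`
  have hq2 : 2 ≤ q := by
    haveI : Finite (𝓞 L ⧸ w.1.asIdeal) := Ideal.finiteQuotientOfFreeOfNeBot w.1.asIdeal w.1.ne_bot
    haveI : Nontrivial (𝓞 L ⧸ w.1.asIdeal) := Ideal.Quotient.nontrivial_iff.2 w.1.isPrime.ne_top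
    rw [hqdef]; exact Finite.one_lt_card
  have hmod : (((unitModulusChar (LocalRing L v) (torusEntry (conjLocal L (IsCMField.complexConj L) v) (cmLocalForm L 3 v) 0 ((cmBorelTriple L 3 v).proj d)) : ℝ≥0) : ℝ) : ℂ) =
      (q : ℂ) := by
    have h := coe_unitModulusChar_uniformizer_eq_inv_card L v w hns _ hduni
    rw [← hqdef, map_inv, NNReal.coe_inv, Complex.ofReal_inv, inv_inj] at h
    exact h
  have hza : χ₁ ϖE = (χ₁ (torusEntry (conjLocal L (IsCMField.complexConj L) v) (cmLocalForm L 3 v) 0 ((cmBorelTriple L 3 v).proj d)))⁻¹ := by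
    rw [← map_inv]
    have h := K2E3SphericalCFunctionShellExpansion.apply_eq_apply_uniformizer_zpow L v χ₁ hχ₁U _ hduni ϖE 1 (fun w' => by rw [hϖE w'])
    rw [zpow_one] at h
    exact h
  have hμval : (((cmTorusCharPair L v χ₁ χ₂) ((cmBorelTriple L 3 v).proj d) : ℂˣ) : ℂ) * ((rootDeltaChar (cmBorelTriple L 3 v).P d : ℂˣ) : ℂ) =
      (((χ₁ ϖE : ℂˣ) : ℂ))⁻¹ * (q : ℂ) := by
    rw [hdδ, hmod, cmTorusCharPair, torusCharPair_apply, hχ₂, MonoidHom.one_apply, mul_one, hza, Units.val_inv_eq_inv_val, inv_inv]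
  exact pair_algebra q hq2 _ _ (Units.ne_zero _)
    (K2E3SphericalCFunctionUnramifiedHypotheses.norm_apply_uniformizer_lt_one_of_contracting L v hns χ₁ hcontr ϖE hϖE) hμval hcrit

/-! ## §2 The ramified rung of U4-f (every ramified place, tame or wild) -/

set_option maxHeartbeats 6400000 in
set_option synthInstance.maxHeartbeats 400000 in
-- statement-level `whnf` on the CM carriers + the letters produced in the proof (class of ★ p856959)
/-- **KEYS' THEOREM §7 (2) («Re s > 0» FORM) AT EVERY RAMIFIED NON-SPLIT PLACE — TAME OR WILD — FOR AN UNRAMIFIED `χ`: U4-f's conclusion VERBATIM under the extra hypotheses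
`hram` (every `w ∣ v` has `e(w|v) ≠ 1`: `v` ramified in `L`) and `hU` (`χ` trivial on `T ∩ K_v`); no hypothesis on `|2|_w`.**  Then a reducible `i_G(χ₁, χ₂)` with `χ₁` non-unitary
contracting has `χ₁ = ‖·‖_E` (the first disjunct; swap (S1): any uniformiser and the ramified quadratic datum of the place ★ `exists_isRamifiedQuadraticDatum_of_placesOver`, then §1 and ★
`eq_halfModulusChar_sq_of_apply_uniformizer` with `(‖ϖ_E‖^{1∕2})² = ‖ϖ_E‖ = N(w)⁻¹`).  Subsumes the tame rung (`|2|_w = 1` is the case `d = 1` of the datum).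
[cite: Keys1984, §7 Theorem (2) (a) p. 126] [cite: Rogawski1990, §12.2 (1) p. 173] [cite: Casselman1980, §3] [cite: Tits1979, §2.4, §2.7] [cite: Serre1979, Ch. IV §1 Prop. 4] -/
theorem keysThmTwoContracting_of_unramified_ramified
    (hns : ∀ w : PlacesOver L v, IsCMField.complexConj L • w.1 = w.1) (hram : ∀ w : PlacesOver L v, v.asIdeal.ramificationIdx' w.1.asIdeal ≠ 1)
    (χ₁ : (UnitaryGroup.LocalRing L v)ˣ →* ℂˣ) (χ₂ : ↥(normOneUnits (conjLocal L (IsCMField.complexConj L) v)) →* ℂˣ)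
    (h₁ : Continuous (fun x => ((χ₁ x : ℂˣ) : ℂ))) (h₂ : Continuous (fun x => ((χ₂ x : ℂˣ) : ℂ))) (hnu : ∃ x, ‖((χ₁ x : ℂˣ) : ℂ)‖ ≠ 1)
    (hcontr : ∀ x : (UnitaryGroup.LocalRing L v)ˣ, unitModulusChar (UnitaryGroup.LocalRing L v) x < 1 → ‖((χ₁ x : ℂˣ) : ℂ)‖ < 1)
    (hU : ∀ t : ↥(torusU (conjLocal L (IsCMField.complexConj L) v) (cmLocalForm L 3 v)),
      (t : ↥(unitaryGroupOfForm (conjLocal L (IsCMField.complexConj L) v) (cmLocalForm L 3 v))) ∈ cmLocalIntegralLevel L 3 (qsForm L) v → cmTorusCharPair L v χ₁ χ₂ t = 1)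
    (hred : ∃ N : Subrepresentation (UnitaryGroup.cmPrincipalSeries L 3 v (UnitaryGroup.cmTorusCharPair L v χ₁ χ₂)), N ≠ ⊥ ∧ N ≠ ⊤) :
    χ₁ = halfModulusChar (UnitaryGroup.LocalRing L v) * halfModulusChar (UnitaryGroup.LocalRing L v) ∨
      (∃ η : (UnitaryGroup.LocalRing L v)ˣ →* ℂˣ, IsQuadraticCharExtension (conjLocal L (IsCMField.complexConj L) v) η ∧
        Continuous (fun x => ((η x : ℂˣ) : ℂ)) ∧ χ₁ = η * halfModulusChar (UnitaryGroup.LocalRing L v)) := by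
  classical
  obtain ⟨w⟩ : Nonempty (PlacesOver L v) := inferInstance
  have hw : IsCMField.complexConj L • w.1 = w.1 := hns w
  -- swap (S1): ANY uniformiser `ϖ` of `L_w` and the ramified quadratic datum it carries (tame `d = 1` and wild `d ≥ 2` alike); then the (G3)-EXPLICIT letters
  obtain ⟨ϖ, hϖ⟩ : ∃ τ : w.1.adicCompletion L, Valued.v τ = WithZero.exp (-1 : ℤ) := by
    obtain ⟨π, hπ⟩ := w.1.valuation_exists_uniformizer L
    exact ⟨(π : w.1.adicCompletion L), by rw [HeightOneSpectrum.valuedAdicCompletion_eq_valuation', hπ]⟩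
  obtain ⟨nd, nt, hD⟩ := F0P3cDyRamWildPlaceDatum.exists_isRamifiedQuadraticDatum_of_placesOver L w hw (hram w) ϖ hϖ
  have hϖ0 : ϖ ≠ 0 := fun h0 => by rw [h0, map_zero] at hϖ; exact WithZero.zero_ne_coe hϖ
  obtain ⟨g₁, hg₁⟩ : ∃ g₁ : GL (Fin 3) (w.1.adicCompletion L), (g₁ : Matrix (Fin 3) (Fin 3) (w.1.adicCompletion L)) = Matrix.diagonal ![(1 : w.1.adicCompletion L), 1, ϖ] := by
    refine ⟨glDiagonal 3 (w.1.adicCompletion L) ![1, 1, Units.mk0 ϖ hϖ0], ?_⟩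
    rw [coe_glDiagonal]
    congr 1
    funext i
    fin_cases i <;> rfl
  have hJw : placeForm (qsForm L) w.1 = (StdForm.antidiagonal 3).over (w.1.adicCompletion L) := by
    rw [placeForm, qsForm, antidiagOne_eq_over, StdForm.over_map]
  obtain ⟨eA, heA⟩ : ∃ eA : Gqs L v ≃ₜ* ↥(unitaryGroupOfForm (galAdicCompletionMap (L := L) (IsCMField.complexConj L) hw) ((StdForm.antidiagonal 3).over (w.1.adicCompletion L))),
      ∀ g : Gqs L v, ((eA g : ↥(unitaryGroupOfForm (galAdicCompletionMap (L := L) (IsCMField.complexConj L) hw) ((StdForm.antidiagonal 3).over (w.1.adicCompletion L)))) :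
          GL (Fin 3) (w.1.adicCompletion L)) =
        ((localNonsplitEquiv (IsCMField.complexConj L) (qsForm L) (IsCMField.complexConj_ne_one L) w hw g :
          ↥(unitaryGroupOfForm (galAdicCompletionMap (L := L) (IsCMField.complexConj L) hw) (placeForm (qsForm L) w.1))) : GL (Fin 3) (w.1.adicCompletion L)) := by
    rw [← hJw]
    exact ⟨localNonsplitEquiv (IsCMField.complexConj L) (qsForm L) (IsCMField.complexConj_ne_one L) w hw, fun g => rfl⟩
  -- a uniformiser unit of `E_v`; its value and module
  obtain ⟨ϖE, hϖE⟩ := F0P3cStCharTSTorusRay.exists_uniformizer_units L v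
  have hz := apply_uniformizer_eq_of_isRamifiedQuadraticDatum L v w hw eA heA hns hD g₁ hg₁ _ _ _ rfl rfl rfl χ₁ χ₂ h₁ h₂ hnu hcontr hU hred ϖE hϖE
  have hχ₁U : ∀ u ∈ (Submonoid.pi Set.univ (fun w' : PlacesOver L v => (w'.1.adicCompletionIntegers L).toSubring.toSubmonoid)).units, χ₁ u = 1 :=
    fun u hu => K2E3SphericalCFunctionUnramifiedHypotheses.apply_eq_one_of_mem_unitsIntegers_of_trivial L v hns χ₁ χ₂ hU u hu
  have hsq : ((halfModulusChar (UnitaryGroup.LocalRing L v) ϖE : ℂˣ) : ℂ) * ((halfModulusChar (UnitaryGroup.LocalRing L v) ϖE : ℂˣ) : ℂ) =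
      ((Nat.card (𝓞 L ⧸ w.1.asIdeal) : ℂ))⁻¹ := by
    rw [← sq, halfModulusChar_sq, coe_unitModulusChar_uniformizer_eq_inv_card L v w hns ϖE hϖE]
  left
  refine eq_halfModulusChar_sq_of_apply_uniformizer L v hns ϖE hϖE χ₁ hχ₁U (Units.ext ?_)
  rw [Units.val_mul, hsq, hz]

/-! ## §3 U4-f for an unramified `χ` at EVERY non-split place: inert ★ p856959 ∨ ramified §2 -/

/-- At a NON-SPLIT place (`c • w = w` for every `w ∣ v`, so ONE place above `v`, ★ `PlacesOver.subsingleton_of_smul_eq`), `v` NOT unramified in `L` forces `e(w|v) ≠ 1` for every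
`w ∣ v` (Mathlib `Algebra.isUnramifiedIn_iff_forall_ramificationIdx_eq_one`; the tree's `ramificationIdx'` is Mathlib's `ramificationIdx`, ★ `Ideal.ramificationIdx'_eq_ramificationIdx`).
Local copy of ★ `Rogawski1990.ramificationIdx'_ne_one_of_not_isUnramifiedIn_of_subsingleton` in the `hns` currency of U4-f (keeps the import closure inside the Keys cone).
[cite: Serre1979, Ch. I §4, Ch. IV §1] -/
theorem ramificationIdx'_ne_one_of_not_isUnramifiedIn_of_nonsplit (hns : ∀ w : PlacesOver L v, IsCMField.complexConj L • w.1 = w.1)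
    (hv : ¬ Algebra.IsUnramifiedIn (𝓞 L) v.asIdeal) (w : PlacesOver L v) : v.asIdeal.ramificationIdx' w.1.asIdeal ≠ 1 := by
  haveI : Algebra.IsQuadraticExtension ↥(maximalRealSubfield L) L := IsCMField.isQuadraticExtension L
  haveI : Subsingleton (PlacesOver L v) := PlacesOver.subsingleton_of_smul_eq (IsCMField.complexConj L) (IsCMField.complexConj_ne_one L) w (hns w)
  intro he
  apply hv
  rw [Algebra.isUnramifiedIn_iff_forall_ramificationIdx_eq_one]
  intro 𝔓 _ h𝔓
  have hne : 𝔓 ≠ ⊥ := Ideal.ne_bot_of_liesOver_of_ne_bot v.ne_bot 𝔓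
  -- the place of `L` defined by `𝔓` lies over `v`, hence IS `w`
  let w' : HeightOneSpectrum (𝓞 L) := ⟨𝔓, inferInstance, hne⟩
  have hw' : w'.under (𝓞 ↥(maximalRealSubfield L)) = v := HeightOneSpectrum.ext (h𝔓.over).symm
  have hww : (⟨w', hw'⟩ : PlacesOver L v) = w := Subsingleton.elim _ _
  have h𝔓w : 𝔓 = w.1.asIdeal := by rw [← hww]
  rw [← Ideal.ramificationIdx'_eq_ramificationIdx v.asIdeal 𝔓 v.ne_bot, h𝔓w]
  exact he

set_option maxHeartbeats 6400000 in
set_option synthInstance.maxHeartbeats 400000 in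
-- statement-level `whnf` on the CM carriers (class of ★ p856959 ∕ §2)
/-- **KEYS' THEOREM §7 (2) («Re s > 0» FORM) FOR AN UNRAMIFIED `χ` AT EVERY NON-SPLIT PLACE — inert, tamely ramified or wildly ramified: U4-f's binder text VERBATIM plus the SINGLE
extra hypothesis `hU` (`χ` trivial on `T ∩ K_v`).**  By cases on `Algebra.IsUnramifiedIn (𝓞 L) v`: unramified ⇒ the INERT rung ★ p856959
`K2E3KeysThmTwoContractingUnramified.keysThmTwoContracting_of_unramified_inert`; not unramified ⇒ `e(w|v) ≠ 1` for every `w ∣ v` (§3 helper) ⇒ the RAMIFIED rung §2.  After this file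
the residue of U4-f is EXACTLY the ramified-`χ` case (`hU` fails: no Iwahori-fixed vector — Road I, the γ-factor of the rank-one intertwining operator).
[cite: Keys1984, §7 Theorem (2) (a) p. 126] [cite: Rogawski1990, §12.2 (1) p. 173] [cite: Casselman1980, §3] [cite: Tits1979, §2.4, §2.7] -/
theorem keysThmTwoContracting_of_unramified_nonsplit
    (hns : ∀ w : PlacesOver L v, IsCMField.complexConj L • w.1 = w.1)
    (χ₁ : (UnitaryGroup.LocalRing L v)ˣ →* ℂˣ) (χ₂ : ↥(normOneUnits (conjLocal L (IsCMField.complexConj L) v)) →* ℂˣ)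
    (h₁ : Continuous (fun x => ((χ₁ x : ℂˣ) : ℂ))) (h₂ : Continuous (fun x => ((χ₂ x : ℂˣ) : ℂ))) (hnu : ∃ x, ‖((χ₁ x : ℂˣ) : ℂ)‖ ≠ 1)
    (hcontr : ∀ x : (UnitaryGroup.LocalRing L v)ˣ, unitModulusChar (UnitaryGroup.LocalRing L v) x < 1 → ‖((χ₁ x : ℂˣ) : ℂ)‖ < 1)
    (hU : ∀ t : ↥(torusU (conjLocal L (IsCMField.complexConj L) v) (cmLocalForm L 3 v)),
      (t : ↥(unitaryGroupOfForm (conjLocal L (IsCMField.complexConj L) v) (cmLocalForm L 3 v))) ∈ cmLocalIntegralLevel L 3 (qsForm L) v → cmTorusCharPair L v χ₁ χ₂ t = 1)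
    (hred : ∃ N : Subrepresentation (UnitaryGroup.cmPrincipalSeries L 3 v (UnitaryGroup.cmTorusCharPair L v χ₁ χ₂)), N ≠ ⊥ ∧ N ≠ ⊤) :
    χ₁ = halfModulusChar (UnitaryGroup.LocalRing L v) * halfModulusChar (UnitaryGroup.LocalRing L v) ∨
      (∃ η : (UnitaryGroup.LocalRing L v)ˣ →* ℂˣ, IsQuadraticCharExtension (conjLocal L (IsCMField.complexConj L) v) η ∧
        Continuous (fun x => ((η x : ℂˣ) : ℂ)) ∧ χ₁ = η * halfModulusChar (UnitaryGroup.LocalRing L v)) := by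
  by_cases hunr : Algebra.IsUnramifiedIn (𝓞 L) v.asIdeal
  · exact K2E3KeysThmTwoContractingUnramified.keysThmTwoContracting_of_unramified_inert L v hns hunr χ₁ χ₂ h₁ h₂ hnu hcontr hU hred
  · exact keysThmTwoContracting_of_unramified_ramified L v hns (ramificationIdx'_ne_one_of_not_isUnramifiedIn_of_nonsplit L v hns hunr) χ₁ χ₂ h₁ h₂ hnu hcontr hU hred

end Summit.HodgeConjecture.HodgeConjecture.Cruxes.H413.K2E3KeysThmTwoContractingRamified

end
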